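import Summits.BirchSwinnertonDyer.Rank1Residual.GaloisImage.MultiplicativeTateFormTransport
import Literature.NumberTheory.EllipticCurves.SpectralValuationUnramified
import HarnessLib

/-!
# BSD rank-≤1 residual cell: at a multiplicative `v ∣ p` with `p ∤ ord_v Δ_min` the inertia group
# fixes NO non-zero point of `E[p]` (Serre 1972 §1.12 — valuation half of the Kummer criterion)

HONEST FRAMING (cell `b2b-bsdres-*`, verbatim): the goal of the cell is to DELETE the
COMBINATION-SHAPED residual classes for ALL analytic-rank `≤ 1` elliptic curves over `ℚ` — "full BSD
formula for every rank `≤ 1` curve in class C" assembled STRICTLY from published theorems — so that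
the rank-`≤ 1` remainder becomes exactly the CONSTRUCTION-SHAPED classes, which are TYPED, NOT
attempted; this is not "finishing BSD".  Unit `b2b-bsdres-x11c` (gen 8).  Theorems only (no
definition, no named fact); a TOOL file about `E[p]|Γ_{K_v}` at a multiplicative `v ∣ p`; no class
theorem, no label moves.  Consumer: `MultiplicativeValuationLargeImage.lean` (`E/ℚ`, `p` odd:
`Irr ∧ Mult ∧ p ∤ ord_p Δ_min ⟹ Surj`).

* `eq_zero_of_forall_inertia_smul_eq_of_hasMultiplicativeReductionAt_of_not_dvd` — `E` an elliptic
  curve over a number field `K`, `p` odd, `v ∣ p` MULTIPLICATIVE with `𝔪_v = (p)` (`e(v ∣ p) = 1`,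
  e.g. `K = ℚ`) and `p ∤ ord_v(Δ_min)`: **every point of `E[p]` fixed by the inertia group
  `I_𝔐 ≤ Γ_{K_v}` (acting through `Γ_{K_v} → Γ_K`) is `O`** — `E[p]^{I_v} = E[p](K_v^nr) = 0`.

On the Tate curve (`E ≃ E_q` over `K_v^nr`, `v(q) = ord_v Δ_min = n`): `E_q[p](K_v^nr) =
{x : x^p ∈ q^ℤ}/q^ℤ`, and `x^p = q^k`, `x ∈ K_v^nr` force `p v(x) = k n`, so `p ∣ k` when `p ∤ n`
(Serre 1972 §1.12: `E_p` is the Kummer extension of `ℤ/p` by `μ_p` attached to `q`).  The tree has no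
Tate uniformisation; the proof is the elementary one on the TATE FORM `T` of invariant `j(E)` over
`K̄_v` (`|a₆(T)| = |Δ_min| = |p|ⁿ`), to which `E(K̄)` is carried by the inertia-equivariant `Ψ` of
`MultiplicativeTateFormTransport.lean` (unramified twist: `c₄, c₆` units, `p ≠ 2`).  For `P ≠ O`
fixed by `I_𝔐`: (i) `ΨP` in the kernel of reduction `T₁` is impossible — its parameter `z = -x/y`
lies in `K_v^nr`, so `|z| = |p|^m`, `m ≥ 1` (`exists_spectralValuation_eq_pow_of_forall_inertia`),
against `|p| ≤ |z|^{p-1}` for a `p`-torsion point of `T₁` (Newton polygon of `ψ_p`,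
`TateForm.valuation_natCast_le_pow_of_one_lt`; *AEC* IV.6.1 with `v(p) = 1 < p - 1`); (ii) `T₀ ∖ T₁`
carries no `p`-power torsion; (iii) so `ΨP` and all its non-zero multiples are SMALL (`|x| < 1`), and
the top one `Q` has `|x_Q|^p = |a₆(T)| = |p|ⁿ` (`TateForm.pow_addOrderOf_eq_of_top`: levels add —
the shadow of `E_q(K)/E_{q,0}(K) ≅ ℤ/v(q)`), while `x_Q ∈ K_v^nr` gives `|x_Q| = |p|^m`: `pm = n`.

NOT claimed: anything when `p ∣ ord_v Δ_min` (then `E[p]^{I_v} ≠ 0` iff the unit part of `q` is a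
`p`-th power in `𝓞_v^nr` — not formalised), `p = 2`, `e(v ∣ p) > 1`.

References: [SerreInventiones1972] §1.12 (Cor. of Prop. 13); [SilvermanATAEC1994] V.3 Thm. 3.1,
V.4 Lemmas 4.1.1–4.1.4, Cor. IV.9.2(d), Ex. 5.13; [SilvermanAEC2009] IV.6.1, VII.2.1–VII.3.1;
[NeukirchANT1999] II (7.5), (9.11).
-/

noncomputable section

open scoped Classical NNReal NumberField Pointwise
open NumberField IsDedekindDomain Field

namespace Summit.BirchSwinnertonDyer.Rank1Residual.GaloisImage

open WeierstrassCurve Literature.NumberTheory.EllipticCurves Literature.NumberTheory.GaloisRepresentations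
  IsDedekindDomain.HeightOneSpectrum

set_option maxHeartbeats 800000 in
/-- **`E[p]^{I_v} = 0` at a multiplicative `v ∣ p` with `𝔪_v = (p)` and `p ∤ ord_v(Δ_min)`, `p`
odd.**  For `E` elliptic over a number field `K`, `𝔐` the prime of `\bar 𝓞_v`: a point `P ∈ E[p]`
fixed by every element of the inertia group `I_𝔐 ≤ Γ_{K_v}` (acting through `Γ_{K_v} → Γ_K`) is `O`.
Serre 1972 §1.12 on the Tate curve (`E[p] ↔ K_v^nr(ζ_p, q^{1/p})`, `p ∤ v(q)`); proved on the Tate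
form of invariant `j(E)` — see the module docstring.
[cite: SerreInventiones1972, §1.12 (Cor. of Prop. 13)]
[cite: SilvermanATAEC1994, V.4 Lemmas 4.1.1–4.1.4 and Cor. IV.9.2(d)]
[cite: SilvermanAEC2009, IV.6.1 and VII.3.1] -/
theorem eq_zero_of_forall_inertia_smul_eq_of_hasMultiplicativeReductionAt_of_not_dvd
    {K : Type} [Field K] [NumberField K] (W : WeierstrassCurve K) [W.IsElliptic]
    (p : ℕ) [hp : Fact p.Prime] (hp2 : p ≠ 2)
    (v : HeightOneSpectrum (𝓞 K)) (hpv : (p : 𝓞 K) ∈ v.asIdeal)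
    (hmult : W.HasMultiplicativeReductionAt v) (hndvd : ¬ p ∣ W.ordMinimalDiscriminant v)
    (hgen : ∀ c ∈ IsLocalRing.maximalIdeal (v.adicCompletionIntegers K),
      ((p : ℕ) : v.adicCompletionIntegers K) ∣ c)
    {w : Valuation (AlgebraicClosure (v.adicCompletion K)) ℝ≥0}
    (hw : ∀ x, (w x : ℝ) =
      spectralNorm (v.adicCompletion K) (AlgebraicClosure (v.adicCompletion K)) x)
    {𝔐 : Ideal v.localAbsIntegers} (h𝔐 : 𝔐 ∈ v.localPrimesAbove)
    {P : geomTorsion W (p : ℤ)}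
    (hfix : ∀ τ ∈ 𝔐.inertia (absoluteGaloisGroup (v.adicCompletion K)),
      absGaloisRestrict K (v.adicCompletion K) τ • P = P) :
    P = 0 := by
  have hp0 : p ≠ 0 := hp.out.ne_zero
  have hA : Nat.card (geomTorsion W p) = p ^ 2 :=
    card_torsionBy_eq_sq (E := W.baseChange (AlgebraicClosure K)) (n := p) (by exact_mod_cast hp0)
  haveI : Finite (geomTorsion W p) := Nat.finite_of_card_ne_zero (by rw [hA]; positivity)
  by_contra hP0
  /- Step 0: the Tate form `T` of invariant `j` and the transport `Ψ : E(K̄) → T(K̄_v)`. -/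
  have hjw : 1 < w (algebraMap K (AlgebraicClosure (v.adicCompletion K)) W.j) :=
    W.one_lt_spectralValuation_j_of_hasMultiplicativeReductionAt hw hmult
  obtain ⟨-, -, hT, ha₆, ha₆pos, -⟩ := W.isTateForm_tateFormOfJ_of_one_lt hjw
  have ha₆v := W.spectralValuation_a₆_tateFormOfJ_eq_pow hpv hmult hgen hw
  set T : WeierstrassCurve (AlgebraicClosure (v.adicCompletion K)) :=
    (tateFormOfJ (algebraMap K (v.adicCompletion K) W.j)).baseChange
      (AlgebraicClosure (v.adicCompletion K)) with hTdef
  obtain ⟨Ψ, hΨinj, hΨτ, hker⟩ :=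
    exists_tateForm_transport_of_hasMultiplicativeReductionAt W p hp2 v hpv hmult hw h𝔐
  haveI hint : T.IsIntegral w.integer := hT.isIntegral
  have hpL : (p : (AlgebraicClosure (v.adicCompletion K))) ≠ 0 := by
    haveI : CharZero (AlgebraicClosure (v.adicCompletion K)) :=
      charZero_of_injective_algebraMap (algebraMap K (AlgebraicClosure (v.adicCompletion K))).injective
    exact Nat.cast_ne_zero.mpr hp0
  have hpw : w (p : (AlgebraicClosure (v.adicCompletion K))) < 1 :=
    spectralValuation_natCast_lt_one hw hpv
  have hpw0 : 0 < w (p : (AlgebraicClosure (v.adicCompletion K))) :=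
    (Valuation.pos_iff _).mpr hpL
  -- `p` is a uniformiser of `𝓞_v`
  have hpO : ¬ IsUnit ((p : ℕ) : v.adicCompletionIntegers K) := by
    intro hu
    have h1 := spectralValuation_eq_one_of_isUnit hw hu
    rw [map_natCast, map_natCast] at h1
    exact hpw.ne h1
  have hpirr : Irreducible ((p : ℕ) : v.adicCompletionIntegers K) := by
    rw [IsDiscreteValuationRing.irreducible_iff_uniformizer]
    apply le_antisymm
    · intro c hc
      exact Ideal.mem_span_singleton.mpr (hgen c hc)
    · rw [Ideal.span_le, Set.singleton_subset_iff]
      exact (IsLocalRing.mem_maximalIdeal _).mpr (mem_nonunits_iff.mpr hpO)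
  have hϖp : algebraMap (v.adicCompletion K) (AlgebraicClosure (v.adicCompletion K))
      (((p : ℕ) : v.adicCompletionIntegers K) : v.adicCompletion K) =
        (p : AlgebraicClosure (v.adicCompletion K)) := by
    have hc : (((p : ℕ) : v.adicCompletionIntegers K) : v.adicCompletion K) =
        (p : v.adicCompletion K) := by norm_cast
    rw [hc, map_natCast]
  /- Step 1: `Ψ` on `E[p]`. -/
  set Ψ' : geomTorsion W (p : ℤ) →+ T.toAffine.Point :=
    Ψ.comp (geomTorsion W (p : ℤ)).subtype with hΨ'
  have hΨ'inj : Function.Injective Ψ' := hΨinj.comp Subtype.val_injective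
  have hΨ'apply : ∀ Q : geomTorsion W (p : ℤ), Ψ' Q = Ψ (Q : geomPoints W) := fun Q ↦ rfl
  have hpQ : ∀ Q : geomTorsion W (p : ℤ), ((p ^ 1 : ℕ) : ℤ) • (Q : geomPoints W) = 0 := fun Q ↦ by
    rw [pow_one]; exact (Submodule.mem_torsionBy_iff _ _).mp Q.2
  have hpΨ' : ∀ Q : geomTorsion W (p : ℤ), (p : ℤ) • Ψ' Q = 0 := fun Q ↦ by
    have h := hpQ Q
    rw [pow_one] at h
    rw [hΨ'apply, ← map_zsmul, h, map_zero]
  -- the kernel estimate: a non-small affine `Ψ' Q` has `|x| > 1` and `|p| ≤ |z|^{p-1}`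
  have hzest : ∀ (Q : geomTorsion W (p : ℤ)) {xd yd} {hd : T.toAffine.Nonsingular xd yd},
      Ψ' Q = .some xd yd hd → ¬ w xd < 1 →
        1 < w xd ∧ w (p : AlgebraicClosure (v.adicCompletion K)) ≤ w (-xd / yd) ^ (p - 1) := by
    intro Q xd yd hd hQ hns
    have hxd : 1 < w xd := hker (Q : geomPoints W) 1 (hpQ Q) (by rw [← hΨ'apply, hQ]) hns
    have hpD : (p : ℤ) • (Affine.Point.some xd yd hd : T.toAffine.Point) = 0 := by
      rw [← hQ]; exact hpΨ' Q
    exact ⟨hxd, TateForm.valuation_natCast_le_pow_of_one_lt hT hp2 hpL hxd hpD⟩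
  /- Step 2: the inertia-fixed points form a subgroup containing `ℤ P`; their `Ψ`-images have
     coordinates fixed by `I_𝔐`. -/
  set Fix : AddSubgroup (geomTorsion W (p : ℤ)) :=
    { carrier := {Q | ∀ τ ∈ 𝔐.inertia (absoluteGaloisGroup (v.adicCompletion K)),
        absGaloisRestrict K (v.adicCompletion K) τ • Q = Q}
      zero_mem' := fun τ _ ↦ smul_zero _
      add_mem' := fun {x y} hx hy τ hτ ↦ by
        simp only [Set.mem_setOf_eq] at hx hy
        rw [smul_add, hx τ hτ, hy τ hτ]
      neg_mem' := fun {x} hx τ hτ ↦ by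
        simp only [Set.mem_setOf_eq] at hx
        rw [smul_neg, hx τ hτ] } with hFixdef
  have hmemFix : ∀ Q : geomTorsion W (p : ℤ), Q ∈ Fix ↔
      ∀ τ ∈ 𝔐.inertia (absoluteGaloisGroup (v.adicCompletion K)),
        absGaloisRestrict K (v.adicCompletion K) τ • Q = Q := fun Q ↦ Iff.rfl
  have hPFix : P ∈ Fix := hfix
  have hzmul : AddSubgroup.zmultiples P ≤ Fix := AddSubgroup.zmultiples_le_of_mem hPFix
  have hfixcoord : ∀ Q : geomTorsion W (p : ℤ), Q ∈ Fix → ∀ {x y}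
      {hxy : T.toAffine.Nonsingular x y},
      Ψ' Q = .some x y hxy → ∀ τ ∈ 𝔐.inertia (absoluteGaloisGroup (v.adicCompletion K)),
        absoluteGaloisGroup.toAlgEquiv (v.adicCompletion K) τ x = x ∧
          absoluteGaloisGroup.toAlgEquiv (v.adicCompletion K) τ y = y := by
    intro Q hQ x y hxy hQeq τ hτ
    have h1 := hΨτ τ hτ (Q : geomPoints W)
    rw [← Literature.NumberTheory.EllipticCurves.AddSubgroup.torsionBy.coe_smul,
      (hmemFix Q).mp hQ τ hτ, ← hΨ'apply, hQeq, Affine.Point.map_some] at h1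
    obtain ⟨hx, hy⟩ := (Affine.Point.some.injEq _ _ _ _ _ _).mp h1
    exact ⟨hx.symm, hy.symm⟩
  /- Step 3: a non-zero fixed point is SMALL — in the kernel of reduction `|z| = |p|^m`, `m ≥ 1`,
     contradicts `|p| ≤ |z|^{p-1}`. -/
  have hsmall : ∀ Q : geomTorsion W (p : ℤ), Q ∈ Fix → Q ≠ 0 → TateForm.IsSmall w (Ψ' Q) := by
    intro Q hQ hQ0
    rcases hD : Ψ' Q with _ | ⟨xd, yd, hd⟩
    · exfalso
      apply hQ0
      apply hΨ'inj
      rw [hD, ← Affine.Point.zero_def, map_zero]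
    rw [TateForm.isSmall_some]
    by_contra hns
    obtain ⟨hxd, hZest⟩ := hzest Q hD hns
    obtain ⟨-, hz1, -, -, -, hz0⟩ := FormalGroupChart.val_zw (V := T) hd.1 hxd
    have hfixz : ∀ σ ∈ 𝔐.inertia (absoluteGaloisGroup (v.adicCompletion K)),
        absoluteGaloisGroup.toAlgEquiv (v.adicCompletion K) σ (-xd / yd) = -xd / yd := by
      intro σ hσ
      obtain ⟨hx, hy⟩ := hfixcoord Q hQ hD σ hσ
      rw [map_div₀, map_neg, hx, hy]
    obtain ⟨m, hm1, hm⟩ := exists_spectralValuation_eq_pow_of_forall_inertia hw h𝔐 hpirr hfixz hz0 hz1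
    rw [hϖp] at hm
    rw [hm, ← pow_mul] at hZest
    have h2 : 1 < m * (p - 1) := by
      have := hp.out.two_le
      calc 1 < 1 * 2 := by norm_num
        _ ≤ m * (p - 1) := Nat.mul_le_mul hm1 (by omega)
    have hlt : w (p : AlgebraicClosure (v.adicCompletion K)) ^ (m * (p - 1)) <
        w (p : AlgebraicClosure (v.adicCompletion K)) ^ 1 :=
      pow_lt_pow_right_of_lt_one₀ hpw0 hpw h2
    rw [pow_one] at hlt
    exact absurd (hZest.trans_lt hlt) (lt_irrefl _)
  /- Step 4: the top small multiple of `P` and its level `|x|^p = |a₆| = |p|ⁿ`. -/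
  haveI : Fintype (geomTorsion W (p : ℤ)) := Fintype.ofFinite _
  set S : Finset (geomTorsion W (p : ℤ)) :=
    Finset.univ.filter (fun Q ↦ Q ∈ AddSubgroup.zmultiples P ∧ TateForm.IsSmall w (Ψ' Q))
    with hSdef
  have hmemS : ∀ Q, Q ∈ S ↔ Q ∈ AddSubgroup.zmultiples P ∧ TateForm.IsSmall w (Ψ' Q) :=
    fun Q ↦ by simp [hSdef]
  have hSne : S.Nonempty :=
    ⟨P, (hmemS P).mpr ⟨AddSubgroup.mem_zmultiples P, hsmall P hPFix hP0⟩⟩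
  let lev : T.toAffine.Point → ℝ≥0 := fun P ↦ match P with
    | .zero => 0
    | @WeierstrassCurve.Affine.Point.some _ _ _ x _ _ => w x
  obtain ⟨x₁, hx₁S, hmax⟩ := S.exists_max_image (fun P ↦ lev (Ψ' P)) hSne
  obtain ⟨hx₁P, hx₁small⟩ := (hmemS x₁).mp hx₁S
  have hx₁Fix : x₁ ∈ Fix := hzmul hx₁P
  rcases hP1 : Ψ' x₁ with _ | ⟨xP, yP, hP⟩
  · rw [hP1] at hx₁small
    exact (TateForm.not_isSmall_zero (hx₁small : TateForm.IsSmall w (0 : T.toAffine.Point))).elim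
  rw [hP1, TateForm.isSmall_some] at hx₁small
  have hxP1 : w xP < 1 := hx₁small
  have hx₁0 : x₁ ≠ 0 := by
    intro h0
    rw [h0, map_zero] at hP1
    exact Affine.Point.some_ne_zero _ hP1.symm
  have hpx₁ : p • x₁ = 0 := by
    rw [← natCast_zsmul]
    exact Subtype.ext ((Submodule.mem_torsionBy_iff _ _).mp x₁.2)
  -- `|x_P|^p = |a₆|`
  have hlev : w xP ^ p = w T.a₆ := by
    refine TateForm.pow_addOrderOf_eq_of_top hT ha₆ hp.out hp2 (h := hP) hxP1 ?_ ?_ ?_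
    · rw [← hP1, addOrderOf_injective Ψ' hΨ'inj, addOrderOf_eq_prime hpx₁ hx₁0]
    · intro k x' y' h' hk hx'
      rw [← hP1, ← map_nsmul] at hk
      have hkS : k • x₁ ∈ S := by
        rw [hmemS, hk, TateForm.isSmall_some]
        exact ⟨AddSubgroup.nsmul_mem _ hx₁P k, hx'⟩
      have := hmax (k • x₁) hkS
      rw [hk, hP1] at this
      exact this
    · intro k hk
      rw [← hP1, ← map_nsmul] at hk ⊢
      by_contra hne
      have hk0 : k • x₁ ≠ 0 := fun h0 ↦ hne (by rw [h0, map_zero])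
      exact hk (hsmall (k • x₁) (hzmul (AddSubgroup.nsmul_mem _ hx₁P k)) hk0)
  have hxP0 : 0 < w xP := by
    refine lt_of_le_of_ne zero_le fun h0 ↦ ?_
    rw [← h0, zero_pow hp0] at hlev
    exact ha₆pos.ne hlev
  /- Step 5: `x_P ∈ K_v^nr`, so `|x_P| = |p|^m`; then `p m = ord_v Δ_min`. -/
  have hfixx : ∀ σ ∈ 𝔐.inertia (absoluteGaloisGroup (v.adicCompletion K)),
      absoluteGaloisGroup.toAlgEquiv (v.adicCompletion K) σ xP = xP :=
    fun σ hσ ↦ (hfixcoord x₁ hx₁Fix hP1 σ hσ).1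
  obtain ⟨m, -, hm⟩ := exists_spectralValuation_eq_pow_of_forall_inertia hw h𝔐 hpirr hfixx hxP0 hxP1
  rw [hϖp] at hm
  have hpm : w (p : AlgebraicClosure (v.adicCompletion K)) ^ (m * p) =
      w (p : AlgebraicClosure (v.adicCompletion K)) ^ W.ordMinimalDiscriminant v := by
    rw [pow_mul, ← hm, hlev, hTdef, ha₆v]
  have hinj := (pow_right_strictAnti₀ hpw0 hpw).injective hpm
  exact hndvd ⟨m, by rw [← hinj, mul_comm]⟩

end Summit.BirchSwinnertonDyer.Rank1Residual.GaloisImage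

end
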